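import Mathlib.Algebra.Polynomial.Roots
import Mathlib.Tactic.ComputeDegree
import Mathlib.Analysis.Calculus.Darboux
import Literature.Geometry.Lorentzian.KerrSeparatedPotentialBounds
import HarnessLib

/-!
# Critical points of Carter's potential `V = V₀ + V₁` on subextremal Kerr:
# at most seven on `(r₊, ∞)`, strict monotonicity in between

(family `gr`, infrastructure for statement **gr.S24**; namespace `Literature.Geometry.Lorentzian.Kerr`)

Dafermos–Rodnianski–Shlapentokh-Rothman (*Decay for solutions of the wave equation on Kerr
exterior spacetimes III*, arXiv:1402.7034 = Ann. of Math. 183 (2016)) analyse in Lemma 6.3.1 the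
critical points of the frequency-dependent part `V₀ = (4Mramω − a²m² + ΔΛ)/(r² + a²)²` of Carter's
potential through the cubic `P = (r² + a²)³ dV₀/dr` (`Kerr.critPoly`, `KerrSeparatedTrapping.lean`):
a nonzero cubic has at most three zeros, whence the trichotomy of that lemma. This file records the
same (cruder, but uniform in the frequencies) count for the **full** potential `V = V₀ + V₁`:
with the sextic `P₁ = (r² + a²)⁵ dV₁/dr` (`Kerr.critPoly₁`, `KerrSeparatedPotentialBounds.lean`),

  `dV/dr = N(r)/(r² + a²)⁵`,  `N = P·(r² + a²)² + P₁`  a real polynomial of degree `≤ 7`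

(`exists_polynomial_critPoly`, `exists_polynomial_deriv_sepPotential`), and for `|a| < M` and an
admissible triple `(ω, m, Λ)` (Def. 6.1.1) `N(7M) < 0` (`P(7M) ≤ 0`,
`Kerr.critPoly_nonpos_of_seven_mul_le`; `P₁(7M) < 0`, `Kerr.critPoly₁_neg_of_five_mul_le`), so
`N ≢ 0` has at most seven real roots:

* `sepPotential_criticalPoints`: there is a finite set `S ⊂ ℝ`, `#S ≤ 7`, containing every
  critical point of `V` in `(r₊, ∞)`;
* `sepPotential_strictMonoOn_or_strictAntiOn`: on every `[r₁, r₂]` with `r₁ ≥ r₊` on whose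
  interior `dV/dr ≠ 0`, `V` is strictly monotone (Darboux: the derivative has constant sign on
  `(r₁, r₂)`; then the mean value theorem). Only `0 < M` is needed here (`r₁ ≥ r₊ ≥ M > 0` keeps
  the denominators `r² + a²` positive).

Consequently `(r₊, ∞)` splits into at most eight intervals of strict monotonicity of `V`,
uniformly in `(ω, m, Λ)` — the form in which the (decrease)/(someBoundS) bookkeeping of §8 is
consumed downstream. The bound `7` is not claimed to be sharp.

## References

* M. Dafermos, I. Rodnianski, Y. Shlapentokh-Rothman, arXiv:1402.7034 = Ann. of Math. 183
  (2016), §6.2 (`V = V₀ + V₁`), Lemma 6.3.1 and its proof (critical points of `V₀` via the cubic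
  `P`), §8.4 (decrease) (key `DafermosRodnianskiShlapentokhrothman2014`).
-/

noncomputable section

open Set Polynomial

namespace Literature.Geometry.Lorentzian

namespace Kerr

/-! ### The numerator polynomial `N = P·(r² + a²)² + P₁` of `dV/dr` -/

/-- **`P·(r² + a²)² + P₁` is a real polynomial of degree `≤ 7`** (explicitly
`N = −2Λr⁷ + (6ΛM − 12Mamω − 6M)r⁶ + ⋯`, expanding the cubic `P = critPoly` and the sextic
`P₁ = critPoly₁`). [folklore] -/
theorem exists_polynomial_critPoly (M a ω : ℝ) (m : ℤ) (Λ : ℝ) :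
    ∃ N : Polynomial ℝ, N.natDegree ≤ 7 ∧
      ∀ r, N.eval r = critPoly M a ω m Λ r * (r ^ 2 + a ^ 2) ^ 2 + critPoly₁ M a r := by
  refine ⟨C (-2 * Λ) * X ^ 7 + C (-12 * m * a * M * ω + 6 * Λ * M - 6 * M) * X ^ 6 +
      C (4 * a ^ 2 * (m : ℝ) ^ 2 - 6 * Λ * a ^ 2 + 16 * M ^ 2 - 4 * a ^ 2) * X ^ 5 +
      C (-20 * m * a ^ 3 * M * ω + 10 * Λ * M * a ^ 2 + 30 * M * a ^ 2) * X ^ 4 +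
      C (8 * a ^ 4 * (m : ℝ) ^ 2 - 6 * Λ * a ^ 4 - 64 * M ^ 2 * a ^ 2 - 8 * a ^ 4) * X ^ 3 +
      C (-4 * m * a ^ 5 * M * ω + 2 * Λ * M * a ^ 4 + 30 * M * a ^ 4) * X ^ 2 +
      C (4 * a ^ 6 * (m : ℝ) ^ 2 - 2 * Λ * a ^ 6 + 16 * M ^ 2 * a ^ 4 - 4 * a ^ 6) * X +
      C (4 * m * a ^ 7 * M * ω - 2 * Λ * M * a ^ 6 - 6 * M * a ^ 6), ?_, fun r ↦ ?_⟩
  · compute_degree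
  · simp only [eval_add, eval_mul, eval_C, eval_pow, eval_X]
    unfold critPoly critPoly₁
    ring

/-- **`dV/dr = N(r)/(r² + a²)⁵` with a real polynomial `N` of degree `≤ 7`** (wherever
`r² + a² ≠ 0`): `dV/dr = P/(r² + a²)³ + P₁/(r² + a²)⁵` (DRSR arXiv:1402.7034, §6.2 and the proof
of Lemma 6.3.1 for the `V₀`-part). [cite: DafermosRodnianskiShlapentokhrothman2014, Lemma 6.3.1 (proof)] -/
theorem exists_polynomial_deriv_sepPotential (M a ω : ℝ) (m : ℤ) (Λ : ℝ) :
    ∃ N : Polynomial ℝ, N.natDegree ≤ 7 ∧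
      (∀ r, N.eval r = critPoly M a ω m Λ r * (r ^ 2 + a ^ 2) ^ 2 + critPoly₁ M a r) ∧
      ∀ r, r ^ 2 + a ^ 2 ≠ 0 →
        deriv (sepPotential M a ω m Λ) r = N.eval r / (r ^ 2 + a ^ 2) ^ 5 := by
  obtain ⟨N, hdeg, hN⟩ := exists_polynomial_critPoly M a ω m Λ
  refine ⟨N, hdeg, hN, fun r hr ↦ ?_⟩
  rw [deriv_sepPotential_eq M a ω m Λ hr, hN]
  field_simp

/-! ### At most seven critical points -/

/-- **Carter's potential has at most seven critical points on `(r₊, ∞)`**: for `0 < M`,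
`|a| < M` and an admissible frequency triple `(ω, m, Λ)` there is a finite set `S` of real
numbers with `#S ≤ 7` such that every `r > r₊` with `dV/dr(r) = 0` lies in `S`. Indeed
`dV/dr = N/(r² + a²)⁵` with `deg N ≤ 7` and `N(7M) = P(7M)((7M)² + a²)² + P₁(7M) < 0`, so `N ≠ 0`
and `S = ` the set of real roots of `N` works. This extends to `V = V₀ + V₁` the critical-point count
behind DRSR arXiv:1402.7034, Lemma 6.3.1 (there for `V₀` via the cubic `P`).
[cite: DafermosRodnianskiShlapentokhrothman2014, Lemma 6.3.1] -/
theorem sepPotential_criticalPoints {M a ω Λ : ℝ} {m : ℤ} (hM : 0 < M) (hMa : IsSubextremal M a)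
    (hadm : IsAdmissibleTriple a ω m Λ) :
    ∃ S : Finset ℝ, S.card ≤ 7 ∧
      ∀ r, rPlus M a < r → deriv (sepPotential M a ω m Λ) r = 0 → r ∈ S := by
  obtain ⟨N, hdeg, hN, hd⟩ := exists_polynomial_deriv_sepPotential M a ω m Λ
  -- `N ≠ 0` since `N(7M) < 0`
  have hN0 : N ≠ 0 := by
    intro h
    have h7 : N.eval (7 * M) < 0 := by
      rw [hN]
      have h1 : critPoly M a ω m Λ (7 * M) * ((7 * M) ^ 2 + a ^ 2) ^ 2 ≤ 0 :=
        mul_nonpos_of_nonpos_of_nonneg (critPoly_nonpos_of_seven_mul_le hMa hadm le_rfl)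
          (by positivity)
      have h2 : critPoly₁ M a (7 * M) < 0 :=
        critPoly₁_neg_of_five_mul_le hM (le_of_lt hMa) (by linarith)
      linarith
    rw [h, eval_zero] at h7
    exact lt_irrefl 0 h7
  refine ⟨N.roots.toFinset, ?_, fun r hr h0 ↦ ?_⟩
  · calc N.roots.toFinset.card ≤ Multiset.card N.roots := Multiset.toFinset_card_le _
      _ ≤ N.natDegree := card_roots' N
      _ ≤ 7 := hdeg
  · have hr0 : 0 < r := (hM.trans_le (M_le_rPlus M a)).trans hr
    have hD : 0 < r ^ 2 + a ^ 2 := by positivity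
    rw [hd r hD.ne', div_eq_zero_iff] at h0
    rw [Multiset.mem_toFinset, mem_roots hN0, IsRoot.def]
    exact h0.resolve_right (pow_ne_zero 5 hD.ne')

/-! ### Strict monotonicity between critical points -/

/-- **Between critical points `V` is strictly monotone**: for `0 < M`, `r₁ ≥ r₊` and any `r₂`, if
`dV/dr ≠ 0` on `(r₁, r₂)` then `V` is strictly increasing or strictly decreasing on `[r₁, r₂]`.
(`V` is differentiable on `[r₁, r₂] ⊂ (0, ∞)`; by Darboux's theorem its derivative has constant
sign on `(r₁, r₂)`, and the mean value theorem concludes.) No restriction on `a` or on the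
frequencies is needed. [folklore] -/
theorem sepPotential_strictMonoOn_or_strictAntiOn {M a ω Λ : ℝ} {m : ℤ} (hM : 0 < M)
    {r₁ r₂ : ℝ} (hr₁ : rPlus M a ≤ r₁)
    (hne : ∀ r ∈ Ioo r₁ r₂, deriv (sepPotential M a ω m Λ) r ≠ 0) :
    StrictMonoOn (sepPotential M a ω m Λ) (Icc r₁ r₂) ∨
      StrictAntiOn (sepPotential M a ω m Λ) (Icc r₁ r₂) := by
  have hpos : ∀ r, r₁ ≤ r → r ^ 2 + a ^ 2 ≠ 0 := fun r hr ↦ by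
    have : 0 < r := (hM.trans_le ((M_le_rPlus M a).trans hr₁)).trans_le hr
    positivity
  have hcont : ContinuousOn (sepPotential M a ω m Λ) (Icc r₁ r₂) := fun r hr ↦
    (hasDerivAt_sepPotential M a ω m Λ (hpos r hr.1)).continuousAt.continuousWithinAt
  have hderiv : ∀ r ∈ Ioo r₁ r₂, HasDerivWithinAt (sepPotential M a ω m Λ)
      (deriv (sepPotential M a ω m Λ) r) (Ioo r₁ r₂) r := fun r hr ↦
    (hasDerivAt_sepPotential M a ω m Λ (hpos r hr.1.le)).differentiableAt.hasDerivAt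
      |>.hasDerivWithinAt
  rcases hasDerivWithinAt_forall_lt_or_forall_gt_of_forall_ne (convex_Ioo r₁ r₂) hderiv hne with
    h | h
  · right
    refine strictAntiOn_of_deriv_neg (convex_Icc r₁ r₂) hcont fun r hr ↦ ?_
    rw [interior_Icc] at hr
    exact h r hr
  · left
    refine strictMonoOn_of_deriv_pos (convex_Icc r₁ r₂) hcont fun r hr ↦ ?_
    rw [interior_Icc] at hr
    exact h r hr

end Kerr

end Literature.Geometry.Lorentzian

end
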